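import Summits.HodgeConjecture.HodgeConjecture.Theses.AffinePartDecay
import Literature.AlgebraicGeometry.HodgeTheory.HardLefschetzNFoldHolds
import Literature.AlgebraicGeometry.HodgeTheory.HodgeTypeConjugation

/-!
# Birth skeleton (BC3) — crux `AffineMiddleDegree` of route `AffinePartDecay`

Crux item `stmt-HodgeConjecture-1969`, decl
`Summit.HodgeConjecture.HodgeConjecture.Theses.AffinePartDecay.AffineMiddleDegree`:
for `X/ℂ` smooth projective of dimension `2m`, `H ⊆ X` Zariski-closed with AFFINE complement
`U = X ∖ H`, every rational class `c ∈ H^{2m}(X(ℂ); ℂ)` of Hodge type `(m, m)` lies in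
`algebraicClasses X m ⊔ ker (H^{2m}(X(ℂ)) → H^{2m}(U(ℂ)))` ("Hodge classes of the middle degree are
algebraic modulo classes dying on the affine part").

## The seam: Lefschetz decomposition of the middle degree

The route header locates the difficulty of this crux: "for `H` a smooth hyperplane section the
kernel is `Gysin(H^{2m-2}(H))` […]; the live part is the vanishing/primitive piece `H^{2m}_van`,
where Weil classes of abelian `2m`-folds and transcendental lattices of hypersurfaces sit". We make
that split a typed seam. Let `Λ : HardLefschetzNFold (2m) X` be ANY hard-Lefschetz datum of the tree
(a rational class `h ∈ N¹H²` with `L = h ∪ ·` of bidegree `(1,1)`, hard Lefschetz in dimension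
`2m`, rational descent; exists by the PROVED fact `nonempty_hardLefschetzNFold_holds`, `h = c₁(𝒪(1))`).
In the middle degree `H^{2m} = P^{2m} ⊕ L H^{2m-2}` (Voisin I Cor. 6.26), compatibly with the
rational structure and the Hodge types (Rem. 6.27, §7.1.2); for a rational `(m,m)`-class
`c = c₀ + L b` with `c₀` PRIMITIVE rational `(m,m)` (`L c₀ = 0` in `H^{2m+2}`) and `b` rational of
type `(m-1, m-1)` — this decomposition is DERIVED below from the fields of `Λ` (`L² : H^{2m-2} →
H^{2m+2}` is the hard-Lefschetz bijection; `b := (L²)⁻¹ (L c)`), it is not a stub. The two stubs are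
the two summands:

* `stub_primitiveHeart` — **the heart** (the crux on PRIMITIVE classes): a primitive rational
  `(m,m)`-class lies in `algebraicClasses X m ⊔ ker(restriction to U(ℂ))`. This is where
  the vanishing cohomology lives (Weil classes, transcendental lattices); for `H` a SMOOTH
  hyperplane section of the embedding carrying `h`, `ker = Gysin(H^{2m-2}(H)) = L H^{2m-2}(X)`
  (Thom–Gysin + weak Lefschetz) and the heart IS the crux read on
  `P^{2m} ≅ H^{2m}/L H^{2m-2} ↪ H^{2m}(U)`. Open from fourfolds on (`m = 2`: primitive
  `(2,2)`-classes); `m = 1` is Lefschetz `(1,1)`.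
* `stub_divisibleAtInfinity` — **the Lefschetz-divisible part**: for `b` rational of type
  `(m-1, m-1)`, `L b = h ∪ b ∈ algebraicClasses X m ⊔ ker(restriction to U(ℂ))`. Trivial when `h`
  dies on `U` (`H ⊇` a hyperplane section carrying `h`; restriction is multiplicative), and in general of
  HC-below-the-middle strength (`HC(X, codim m-1) ⇒ b ∈ N^{m-1} ⇒ h ∪ b ∈ Nᵐ`,
  `Λ.lefschetzOperator_mem_algebraicClasses`); known for `m ≤ 2` (Lefschetz `(1,1)` on `b`), open from
  sixfolds on (`m = 3`: `(2,2)`-classes `b ∈ H⁴(X⁶)`). In the route this is what the other crux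
  `WeakLefschetzAlgebraicClasses` + induction pay for below the middle.

`AffineMiddleDegree_of_pieces` is the real (sorry-free) composition: dimension `0` by
`algebraicClasses_zero`; dimension `2(m+1)` by choosing `Λ` (`nonempty_hardLefschetzNFold_holds`),
splitting `c = c₀ + L b` (`exists_primitive_add_lefschetz`, proved here from `Λ`'s fields) and adding
the two stub memberships (`Submodule.add_mem`); `AffineMiddleDegree_of : AffineMiddleDegree` feeds it
the two declared stubs.

Neither stub alone gives the crux (the heart says nothing about `L H^{2m-2}`, the divisible part
nothing about primitive classes) nor the summit; both are consequences of `HodgeConjecture`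
(HC ⇒ every rational `(p,p)`-class is in `Nᵖ`), i.e. consequences used toward `S`. BC3 probes
(`stub → AffineMiddleDegree`, `stub → HodgeConjecture` by `first | exact? | simpa | aesop`) are run
in the sibling probe files and must fail. Degrees are written `2 * (m + 1)`, `2 * m` (no natural
subtraction): the stubs cover dimensions `≥ 2`, dimension `0` being `algebraicClasses_zero`.

Gate shape (`ledger skeleton check` admits, as hypotheses of the theorem concluding the crux BY NAME,
only registered obligations): the implication content lives in the sorry-free
`AffineMiddleDegree_of_pieces : PrimitiveHeart → DivisibleAtInfinity → <the crux statement, verbatim>`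
and `AffineMiddleDegree_of : AffineMiddleDegree` discharges its two hypotheses with the declared stubs
(the file's ONLY theorem headed by the crux name; its only non-whitelisted axiom is the `sorryAx` of
the stubs). `sorry` occurs ONLY in the two `stub_*` theorems. `pieces_of_affineMiddleDegree` records,
sorry-free, that both stub statements are special cases of the crux (converse direction of the probes).
-/

namespace Summit.HodgeConjecture.HodgeConjecture.Cruxes.AffineMiddleDegree.Birth

open Literature.AlgebraicGeometry.Motives
open Literature.AlgebraicGeometry.HodgeTheory
open Literature.Geometry.Kaehler
open Summit.HodgeConjecture.HodgeConjecture.Theses.AffinePartDecay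

/-- **Stub 1 statement — the primitive heart.** For `X` smooth projective of dimension `2(m+1)`,
ANY hard-Lefschetz datum `Λ` (class `h`), `H ⊆ X` closed with affine complement, and every rational
class `c₀ ∈ H^{2(m+1)}(X(ℂ); ℂ)` of type `(m+1, m+1)` which is PRIMITIVE for `h`
(`h ∪ c₀ = 0` in `H^{2(m+2)}`): `c₀ ∈ algebraicClasses X (m+1) ⊔ ker(restriction to (X ∖ H)(ℂ))`.
The crux restricted to primitive classes; open from `m + 1 = 2` (fourfolds) on.
[cite: VoisinHodgeI2002, §6.2.3 Def. 6.24 and Cor. 6.26] [cite: Deligne2000, §1] -/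
def PrimitiveHeart : Prop :=
  ∀ ⦃m : ℕ⦄ ⦃X : SchemeOver ℂ⦄, IsSmoothProjective (2 * (m + 1)) X →
    ∀ (Λ : HardLefschetzNFold (2 * (m + 1)) X) (H : Set X.left) (hH : IsClosed H),
      AlgebraicGeometry.IsAffineOpen (⟨Hᶜ, hH.isOpen_compl⟩ : X.left.Opens) →
        ∀ (c₀ : complexBetti X (2 * (m + 1))), IsRationalClass c₀ →
          IsOfHodgeType (2 * (m + 1)) X (2 * (m + 1)) (m + 1) (m + 1) c₀ →
            lefschetzOperator Λ.hyperplaneClass (two_add_two_mul (m + 1)) c₀ = 0 →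
              c₀ ∈ algebraicClasses X (m + 1) ⊔
                LinearMap.ker (complexBetti.restrictCompl X H (2 * (m + 1))).hom

/-- **Stub 2 statement — the Lefschetz-divisible part at infinity.** For `X` smooth projective of
dimension `2(m+1)`, ANY hard-Lefschetz datum `Λ` (class `h`), `H ⊆ X` closed with affine
complement, and every rational class `b ∈ H^{2m}(X(ℂ); ℂ)` of type `(m, m)`:
`h ∪ b ∈ algebraicClasses X (m+1) ⊔ ker(restriction to (X ∖ H)(ℂ))`. Of HC-below-the-middle
strength (`b ∈ N^m ⇒ h ∪ b ∈ N^{m+1}`, `Λ.lefschetzOperator_mem_algebraicClasses`); trivial when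
`h` dies on `X ∖ H`; known for `m ≤ 1` (Lefschetz `(1,1)`), open from `m = 2` (sixfolds) on.
[cite: VoisinHodgeI2002, Thm. 6.25, Rem. 6.27 and §7.1.2] [cite: VoisinHodgeII2003, §9.2.4 Prop. 9.20] -/
def DivisibleAtInfinity : Prop :=
  ∀ ⦃m : ℕ⦄ ⦃X : SchemeOver ℂ⦄, IsSmoothProjective (2 * (m + 1)) X →
    ∀ (Λ : HardLefschetzNFold (2 * (m + 1)) X) (H : Set X.left) (hH : IsClosed H),
      AlgebraicGeometry.IsAffineOpen (⟨Hᶜ, hH.isOpen_compl⟩ : X.left.Opens) →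
        ∀ (b : complexBetti X (2 * m)), IsRationalClass b →
          IsOfHodgeType (2 * (m + 1)) X (2 * m) m m b →
            lefschetzOperator Λ.hyperplaneClass (two_add_two_mul m) b ∈
              algebraicClasses X (m + 1) ⊔
                LinearMap.ker (complexBetti.restrictCompl X H (2 * (m + 1))).hom

/-- Stub 1 (the heart): primitive middle-degree Hodge classes are algebraic modulo classes dying
on the affine part. [cite: VoisinHodgeI2002, §6.2.3 Cor. 6.26] -/
theorem stub_primitiveHeart : PrimitiveHeart := by
  sorry

/-- Stub 2: the Lefschetz-divisible middle-degree Hodge classes are algebraic modulo classes dying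
on the affine part. [cite: VoisinHodgeI2002, Thm. 6.25, Rem. 6.27 and §7.1.2] -/
theorem stub_divisibleAtInfinity : DivisibleAtInfinity := by
  sorry

/-! ### The seam, proved: Lefschetz decomposition of a middle-degree Hodge class -/

/-- Rational classes are closed under subtraction (from `IsRationalClass.add` / `.smul`).
[cite: HatcherAT2002, §3.1] -/
theorem isRationalClass_sub {Y : Type} [TopologicalSpace Y] {k : ℕ}
    {c c' : Literature.AlgebraicTopology.SingularHomology.singularCohomology ℂ ℂ Y k}
    (hc : IsRationalClass c) (hc' : IsRationalClass c') : IsRationalClass (c - c') := by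
  have h := hc.add (hc'.smul (-1))
  simpa [sub_eq_add_neg] using h

/-- **Lefschetz decomposition of a middle-degree Hodge class** (derived from the fields of a
hard-Lefschetz datum): on `X` smooth projective of dimension `2(m+1)` with datum `Λ` (class `h`),
every rational `(m+1, m+1)`-class `c ∈ H^{2(m+1)}` is `c = c₀ + h ∪ b` with `c₀` rational of type
`(m+1, m+1)` and primitive (`h ∪ c₀ = 0`) and `b ∈ H^{2m}` rational of type `(m, m)`:
`b := (L²)⁻¹(L c)` for the hard-Lefschetz bijection `L² : H^{2m} → H^{2m+4}` (`2m + 2 = dim X`),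
which descends rationality and Hodge type (`Λ.exists_hdg_preimage`), and `c₀ := c - h ∪ b`.
[cite: VoisinHodgeI2002, Thm. 6.25, Cor. 6.26, Rem. 6.27 and §7.1.2] -/
theorem exists_primitive_add_lefschetz {m : ℕ} {X : SchemeOver ℂ}
    (hX : IsSmoothProjective (2 * (m + 1)) X) (Λ : HardLefschetzNFold (2 * (m + 1)) X)
    (c : complexBetti X (2 * (m + 1))) (hc : IsRationalClass c)
    (hcc : IsOfHodgeType (2 * (m + 1)) X (2 * (m + 1)) (m + 1) (m + 1) c) :
    ∃ (c₀ : complexBetti X (2 * (m + 1))) (b : complexBetti X (2 * m)),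
      IsRationalClass c₀ ∧ IsOfHodgeType (2 * (m + 1)) X (2 * (m + 1)) (m + 1) (m + 1) c₀ ∧
        lefschetzOperator Λ.hyperplaneClass (two_add_two_mul (m + 1)) c₀ = 0 ∧
          IsRationalClass b ∧ IsOfHodgeType (2 * (m + 1)) X (2 * m) m m b ∧
            c = c₀ + lefschetzOperator Λ.hyperplaneClass (two_add_two_mul m) b := by
  -- degree bookkeeping: `L¹ : H^{2m} → H^{2(m+1)}`, `L¹ : H^{2(m+1)} → H^{2(m+2)}`, `L² : H^{2m} → H^{2(m+2)}`
  have hm₁ : 2 * m + 2 * 1 = 2 * (m + 1) := by omega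
  have hm₁' : 2 * (m + 1) + 2 * 1 = 2 * (m + 1 + 1) := by omega
  have hm₂ : 2 * m + 2 * 2 = 2 * (m + 1 + 1) := by omega
  have hjk : 2 * m + 2 = 2 * (m + 1) := by omega
  -- the Lefschetz iterates of the datum, spelt with `lefschetzOperator`
  have hL₁ : ∀ x : complexBetti X (2 * m),
      Λ.L 1 (2 * m) (2 * (m + 1)) hm₁ x = lefschetzOperator Λ.hyperplaneClass (two_add_two_mul m) x := by
    intro x
    rw [HardLefschetzNFold.L, lefschetzPowTo_succ_apply Λ.hyperplaneClass 0 (2 * m) (2 * m) (2 * (m + 1)) rfl hm₁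
      (two_add_two_mul m), lefschetzPowTo_zero_apply]
  have hL₁' : ∀ y : complexBetti X (2 * (m + 1)),
      Λ.L 1 (2 * (m + 1)) (2 * (m + 1 + 1)) hm₁' y =
        lefschetzOperator Λ.hyperplaneClass (two_add_two_mul (m + 1)) y := by
    intro y
    rw [HardLefschetzNFold.L, lefschetzPowTo_succ_apply Λ.hyperplaneClass 0 (2 * (m + 1)) (2 * (m + 1))
      (2 * (m + 1 + 1)) rfl hm₁' (two_add_two_mul (m + 1)), lefschetzPowTo_zero_apply]
  have hL₂ : ∀ x : complexBetti X (2 * m),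
      Λ.L 2 (2 * m) (2 * (m + 1 + 1)) hm₂ x =
        lefschetzOperator Λ.hyperplaneClass (two_add_two_mul (m + 1))
          (lefschetzOperator Λ.hyperplaneClass (two_add_two_mul m) x) := by
    intro x
    rw [HardLefschetzNFold.L, lefschetzPowTo_succ_apply Λ.hyperplaneClass 1 (2 * m) (2 * (m + 1))
      (2 * (m + 1 + 1)) hm₁ hm₂ (two_add_two_mul (m + 1)), ← hL₁ x]
  -- `L c` is rational of type `(m+2, m+2)`
  have hLc_rat : IsRationalClass (Λ.L 1 (2 * (m + 1)) (2 * (m + 1 + 1)) hm₁' c) :=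
    Λ.isRationalClass_L 1 _ _ hm₁' hc
  have hLc_typ : IsOfHodgeType (2 * (m + 1)) X (2 * (m + 1 + 1)) (m + 2) (m + 2)
      (Λ.L 1 (2 * (m + 1)) (2 * (m + 1 + 1)) hm₁' c) :=
    Λ.isOfHodgeType_L 1 _ _ hm₁' (m + 1) (m + 1) hcc
  -- `b := (L²)⁻¹ (L c)`, rational of type `(m, m)` by hard Lefschetz (`2m + 2 = dim X`)
  obtain ⟨b, hb_rat, hb_typ, hb⟩ :=
    Λ.exists_hdg_preimage (j := 2) (k := 2 * m) hjk (2 * (m + 1 + 1)) hm₂ m m _ hLc_rat hLc_typ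
  refine ⟨c - lefschetzOperator Λ.hyperplaneClass (two_add_two_mul m) b, b, ?_, ?_, ?_, hb_rat, hb_typ,
    (sub_add_cancel _ _).symm⟩
  · -- rationality of `c₀`
    refine isRationalClass_sub hc ?_
    rw [← hL₁ b]
    exact Λ.isRationalClass_L 1 _ _ hm₁ hb_rat
  · -- Hodge type of `c₀`
    refine hcc.sub hX ?_
    exact Λ.isOfHodgeType_lefschetzOperator (2 * m) (2 * (m + 1)) (two_add_two_mul m) m m b hb_typ
  · -- primitivity: `L c₀ = L c - L² b = 0`
    rw [map_sub, ← hL₂ b, hb, hL₁' c, sub_self]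

/-- **Composition (real proof, sorry-free).** The primitive heart and the divisible part at infinity
give the crux statement (spelt out verbatim; `AffineMiddleDegree` unfolds to it): dimension `0` —
every class is algebraic (`algebraicClasses_zero`); dimension `2(m+1)` — choose a hard-Lefschetz
datum (`nonempty_hardLefschetzNFold_holds`), split `c = c₀ + h ∪ b`
(`exists_primitive_add_lefschetz`) and add the two memberships.
[cite: VoisinHodgeI2002, Thm. 6.25, Cor. 6.26 and Rem. 6.27] -/
theorem AffineMiddleDegree_of_pieces (h₁ : PrimitiveHeart) (h₂ : DivisibleAtInfinity) :
    ∀ ⦃m : ℕ⦄ ⦃X : SchemeOver ℂ⦄, IsSmoothProjective (2 * m) X →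
      ∀ (H : Set X.left) (hH : IsClosed H),
        AlgebraicGeometry.IsAffineOpen (⟨Hᶜ, hH.isOpen_compl⟩ : X.left.Opens) →
          ∀ (c : complexBetti X (2 * m)), IsRationalClass c → IsOfHodgeType (2 * m) X (2 * m) m m c →
            c ∈ algebraicClasses X m ⊔ LinearMap.ker (complexBetti.restrictCompl X H (2 * m)).hom := by
  intro m
  cases m with
  | zero =>
    intro X hX H hH hU c hc hcc
    exact Submodule.mem_sup_left (by rw [algebraicClasses_zero]; exact Submodule.mem_top)
  | succ m =>
    intro X hX H hH hU c hc hcc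
    obtain ⟨Λ⟩ := nonempty_hardLefschetzNFold_holds (2 * (m + 1)) X hX
    obtain ⟨c₀, b, hc₀, hc₀c₀, hprim, hb, hbb, rfl⟩ := exists_primitive_add_lefschetz hX Λ c hc hcc
    exact Submodule.add_mem _ (h₁ hX Λ H hH hU c₀ hc₀ hc₀c₀ hprim) (h₂ hX Λ H hH hU b hb hbb)

/-- **THE SKELETON THEOREM.** The crux
`Summit.HodgeConjecture.HodgeConjecture.Theses.AffinePartDecay.AffineMiddleDegree`, concluded BY NAME
from the two DECLARED stubs (the only `sorry`s of the file) through the sorry-free composition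
`AffineMiddleDegree_of_pieces`. [cite: Deligne2000, §1] [cite: VoisinHodgeI2002, §6.2.3 Cor. 6.26] -/
theorem AffineMiddleDegree_of : AffineMiddleDegree :=
  AffineMiddleDegree_of_pieces stub_primitiveHeart stub_divisibleAtInfinity

/-! ### Sorry-free sanity: both stub statements are special cases of the crux -/

/-- The crux implies both pieces (converse direction of the BC3 probes): the heart by specialisation
(forget `Λ` and primitivity), the divisible part because `h ∪ b` is again rational
(`IsRationalClass.cup`) of type `(m+1, m+1)` (`Λ.isOfHodgeType_lefschetzOperator`). In particular
both stubs are consequences of the Hodge conjecture. [cite: VoisinHodgeI2002, Rem. 6.27 and §7.1.2] -/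
theorem pieces_of_affineMiddleDegree (h : AffineMiddleDegree) : PrimitiveHeart ∧ DivisibleAtInfinity := by
  refine ⟨fun m X hX Λ H hH hU c₀ hc₀ hc₀c₀ _ => h hX H hH hU c₀ hc₀ hc₀c₀, ?_⟩
  intro m X hX Λ H hH hU b hb hbb
  refine h hX H hH hU _ ?_ ?_
  · exact Λ.isRationalClass_hyperplaneClass.cup (two_add_two_mul m) hb
  · exact Λ.isOfHodgeType_lefschetzOperator (2 * m) (2 * (m + 1)) (two_add_two_mul m) m m b hbb

end Summit.HodgeConjecture.HodgeConjecture.Cruxes.AffineMiddleDegree.Birth
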